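import Summits.Langlands.Langlands.Theses.PicardMuOrdinary

/-!
# `MuOrdinaryFamilyRT`: the separability hypothesis is redundant (negative-side analysis)

Load-bearing analysis of the crux `Summit.Langlands.Langlands.Theses.PicardMuOrdinary.MuOrdinaryFamilyRT`
(item stmt-Langlands-13757) by its standing disprover: of the three arithmetic hypotheses
`f.natDegree = 4`, `(f ⊗ ℚ).Separable`, `12 ∣ #Gal(f ⊗ ℚ)`, the middle one is DECORATION —
it follows from the other two (`separable_of_twelve_dvd_card_gal`: an inseparable rational quartic
has at most three distinct roots in its splitting field and `Gal` embeds into their permutations,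
so `#Gal ∣ 3! = 6`).  Consequently any statement of the shape
`∀ f hcpt, deg → sep → gal → B f hcpt` is equivalent to the same statement with `sep` dropped
(`forall_sep_iff`), and in particular the crux follows from its `sep`-free form
(`muOrdinaryFamilyRT_of_dropSep`, the form provers may prefer to attack; the body is the crux's,
verbatim).  Sorry-free; imports only the route file.
-/

set_option linter.dupNamespace false -- project-wide option (lakefile weak.linter.dupNamespace); `Summit.Langlands.Langlands` is the mandated namespace

namespace Summit.Langlands.Langlands.Theorems.MuOrdinaryFamilyRT.Negative

open Polynomial
open Summit.Langlands.Langlands.Theses.PicardMuOrdinary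

/-- A polynomial over a field with a square factor has at most `natDegree - 1` distinct roots in
any field `L` over which it splits. [folklore] -/
theorem natCard_rootSet_succ_le {F L : Type*} [Field F] [Field L] [Algebra F L]
    {g x : F[X]} (hg : g ≠ 0) (hsplit : (g.map (algebraMap F L)).Splits)
    (hx : x * x ∣ g) (hxu : ¬ IsUnit x) :
    Nat.card (g.rootSet L) + 1 ≤ g.natDegree := by
  classical
  have hrs : Nat.card (g.rootSet L) = (g.map (algebraMap F L)).roots.toFinset.card := by
    rw [rootSet_def, Finset.coe_sort_coe, Nat.card_eq_finsetCard]
  rw [hrs]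
  set G := g.map (algebraMap F L) with hG
  have hG0 : G ≠ 0 := Polynomial.map_ne_zero hg
  have hx0 : x ≠ 0 := by
    rintro rfl
    exact hg (by simpa using hx)
  have hxdvd : x.map (algebraMap F L) ∣ G :=
    Polynomial.map_dvd (algebraMap F L) (dvd_trans (dvd_mul_right x x) hx)
  have hxsplit : (x.map (algebraMap F L)).Splits := hsplit.of_dvd hG0 hxdvd
  have hxdeg : (x.map (algebraMap F L)).degree ≠ 0 := by
    rw [degree_map]
    exact (degree_pos_of_ne_zero_of_nonunit hx0 hxu).ne'
  obtain ⟨θ, hθ⟩ := hxsplit.exists_eval_eq_zero hxdeg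
  have hlin : X - C θ ∣ x.map (algebraMap F L) := dvd_iff_isRoot.mpr hθ
  have hsq : (X - C θ) ^ 2 ∣ G := by
    have : x.map (algebraMap F L) * x.map (algebraMap F L) ∣ G := by
      rw [← Polynomial.map_mul]
      exact Polynomial.map_dvd _ hx
    exact dvd_trans (by rw [pow_two]; exact mul_dvd_mul hlin hlin) this
  have hmult : 2 ≤ G.roots.count θ := by
    rw [count_roots]
    exact (le_rootMultiplicity_iff hG0).mpr hsq
  have hθmem : θ ∈ G.roots.toFinset := by
    rw [Multiset.mem_toFinset]
    exact Multiset.count_pos.mp (by omega)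
  have hcard : G.roots.card = g.natDegree := by
    rw [← hsplit.natDegree_eq_card_roots, natDegree_map]
  have hsum := Multiset.toFinset_sum_count_eq G.roots
  rw [← Finset.add_sum_erase _ _ hθmem] at hsum
  have hrest : (G.roots.toFinset.erase θ).card ≤
      ∑ a ∈ G.roots.toFinset.erase θ, G.roots.count a := by
    rw [Finset.card_eq_sum_ones]
    refine Finset.sum_le_sum fun a ha => ?_
    have : a ∈ G.roots := Multiset.mem_toFinset.mp (Finset.mem_of_mem_erase ha)
    exact Multiset.one_le_count_iff_mem.mpr this
  have herase := Finset.card_erase_of_mem hθmem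
  omega

/-- **`hsep` is decoration.** For an integer quartic, `12 ∣ #Gal(f ⊗ ℚ)` already forces
separability over `ℚ`: an inseparable rational quartic has at most `3` distinct roots in its
splitting field, and `Gal` embeds into their permutations, so `#Gal ∣ 3! = 6`. [folklore] -/
theorem separable_of_twelve_dvd_card_gal (f : ℤ[X]) (hdeg : f.natDegree = 4)
    (hgal : 12 ∣ Nat.card (f.map (Int.castRingHom ℚ)).Gal) :
    (f.map (Int.castRingHom ℚ)).Separable := by
  set g := f.map (Int.castRingHom ℚ) with hg
  have hgdeg : g.natDegree = 4 := by
    rw [hg, natDegree_map_eq_of_injective (Int.castRingHom ℚ).injective_int, hdeg]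
  have hg0 : g ≠ 0 := by
    intro h
    rw [h, natDegree_zero] at hgdeg
    exact absurd hgdeg (by norm_num)
  by_contra hsep
  rw [PerfectField.separable_iff_squarefree] at hsep
  obtain ⟨x, hx, hxu⟩ : ∃ x, x * x ∣ g ∧ ¬ IsUnit x := by
    by_contra h
    push Not at h
    exact hsep h
  let L := g.SplittingField
  have hS : (g.map (algebraMap ℚ L)).Splits := SplittingField.splits g
  haveI : Fact ((g.map (algebraMap ℚ L)).Splits) := ⟨hS⟩
  have hdvd : Nat.card g.Gal ∣ (Nat.card (g.rootSet L)).factorial := by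
    rw [← Nat.card_perm]
    exact Subgroup.card_dvd_of_injective _ (Gal.galActionHom_injective g L)
  have hroots : Nat.card (g.rootSet L) ≤ 3 := by
    have h2 : Nat.card (g.rootSet L) + 1 ≤ g.natDegree :=
      natCard_rootSet_succ_le (L := L) hg0 hS hx hxu
    omega
  have h6 : Nat.card g.Gal ∣ Nat.factorial 3 :=
    dvd_trans hdvd (Nat.factorial_dvd_factorial hroots)
  have h12 : 12 ∣ Nat.factorial 3 := dvd_trans hgal h6
  revert h12
  decide

/-- For every family of statements `B f hcpt`, quantifying over generic quartics WITH the
separability hypothesis is the same as quantifying WITHOUT it. [folklore] -/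
theorem forall_sep_iff
    {B : ∀ f : ℤ[X],
      Literature.NumberTheory.Automorphic.isCompact_glFiniteIntegralLevel 3 (CyclotomicField 3 ℚ) →
        Prop} :
    (∀ (f : ℤ[X])
        (hcpt : Literature.NumberTheory.Automorphic.isCompact_glFiniteIntegralLevel 3
          (CyclotomicField 3 ℚ)),
        f.natDegree = 4 → (f.map (Int.castRingHom ℚ)).Separable →
          12 ∣ Nat.card (f.map (Int.castRingHom ℚ)).Gal → B f hcpt) ↔
      ∀ (f : ℤ[X])
        (hcpt : Literature.NumberTheory.Automorphic.isCompact_glFiniteIntegralLevel 3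
          (CyclotomicField 3 ℚ)),
        f.natDegree = 4 → 12 ∣ Nat.card (f.map (Int.castRingHom ℚ)).Gal → B f hcpt :=
  ⟨fun h f hcpt hdeg hgal => h f hcpt hdeg (separable_of_twelve_dvd_card_gal f hdeg hgal) hgal,
    fun h f hcpt hdeg _ hgal => h f hcpt hdeg hgal⟩

section DropSep

open scoped BigOperators Topology Manifold Classical MeasureTheory ProbabilityTheory Matrix InnerProductSpace ComplexConjugate ContinuousMap
open Filter Set Function TopologicalSpace MeasureTheory

/-- **The crux follows from its `sep`-free form** (body verbatim; the converse is trivial).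
[folklore] -/
theorem muOrdinaryFamilyRT_of_dropSep
    (h : ∀ (f : Polynomial ℤ)
      (hcpt : Literature.NumberTheory.Automorphic.isCompact_glFiniteIntegralLevel 3
        (CyclotomicField 3 ℚ)),
      f.natDegree = 4 → 12 ∣ Nat.card (f.map (Int.castRingHom ℚ)).Gal →
        (∃ (P : Literature.NumberTheory.Automorphic.CuspidalAutomorphicRepData 3 (CyclotomicField 3 ℚ) hcpt) (𝔐 : Ideal (integralClosure ℤ ℂ)), P.1.IsRegularAlgebraic ∧ 𝔐.IsMaximal ∧ (3 : (integralClosure ℤ ℂ)) ∈ 𝔐 ∧ ∀ᶠ 𝔭 : IsDedekindDomain.HeightOneSpectrum (NumberField.RingOfIntegers (CyclotomicField 3 ℚ)) in Filter.cofinite, ∃ (α : Multiset ℂ) (Q : Polynomial (integralClosure ℤ ℂ)), P.1.HasSatakeParamAt 𝔭 α ∧ Q.map (algebraMap (integralClosure ℤ ℂ) ℂ) = (α.map (fun a => Polynomial.X - Polynomial.C ((𝔭.residueCard : ℂ) * a))).prod ∧ Q.map (Ideal.Quotient.mk 𝔐) = (if (f.map ((Ideal.Quotient.mk 𝔭.asIdeal).comp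 (algebraMap ℤ (NumberField.RingOfIntegers (CyclotomicField 3 ℚ))))).roots.toFinset.card = 4 then (Polynomial.X - 1) ^ 3 else if (f.map ((Ideal.Quotient.mk 𝔭.asIdeal).comp (algebraMap ℤ (NumberField.RingOfIntegers (CyclotomicField 3 ℚ))))).roots.toFinset.card = 2 then (Polynomial.X - 1) ^ 2 * (Polynomial.X + 1) else if (f.map ((Ideal.Quotient.mk 𝔭.asIdeal).comp (algebraMap ℤ (NumberField.RingOfIntegers (CyclotomicField 3 ℚ))))).roots.toFinset.card = 1 then Polynomial.X ^ 3 - 1 else if (∃ y : ((NumberField.RingOfIntegers (CyclotomicField 3 ℚ)) ⧸ 𝔭.asIdeal), y ^ 2 = (f.map ((Ideal.Quotient.mk 𝔭.asIdeal).comp (algebraMap ℤ (NumberField.RingOfIntegers (CyclotomicField 3 ℚ))))).discr) then (Polynomial.X - 1) * (Polynomial.X + 1) ^ 2 else Polynomial.X ^ 3 + Polynomial.X ^ 2 + Polynomial.X + 1 : Polynomial ℤ).map (Int.castRingHom ((integralClosure ℤ ℂ) ⧸ 𝔐))) →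
        ∃ (e : CyclotomicField 3 ℚ →+* ℂ) (𝔐 : Ideal (integralClosure ℤ ℂ)) (S : Finset (IsDedekindDomain.HeightOneSpectrum (NumberField.RingOfIntegers (CyclotomicField 3 ℚ)))), 𝔐.IsMaximal ∧ (3 : (integralClosure ℤ ℂ)) ∈ 𝔐 ∧ ∀ k : ℕ, ∃ P : Literature.NumberTheory.Automorphic.CuspidalAutomorphicRepData 3 (CyclotomicField 3 ℚ) hcpt, P.1.IsRegularAlgebraic ∧ ∀ 𝔭 ∉ S, ∃ (α : Multiset ℂ) (t u : (integralClosure ℤ ℂ)), P.1.HasSatakeParamAt 𝔭 α ∧ (t : ℂ) = (𝔭.residueCard : ℂ) * α.sum - e (Literature.NumberTheory.GaloisRepresentations.picardTrace f 𝔭) ∧ u ∉ 𝔐 ∧ u * t ∈ Ideal.span {(3 : (integralClosure ℤ ℂ)) ^ k}) :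
    MuOrdinaryFamilyRT :=
  fun f hcpt hdeg _ hgal => h f hcpt hdeg hgal

end DropSep

end Summit.Langlands.Langlands.Theorems.MuOrdinaryFamilyRT.Negative
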